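import Literature.Analysis.PDE.SymmetricHyperbolicEnergy
import Literature.Analysis.PDE.TorusSymmetricHyperbolicEnergy
import Literature.Analysis.FunctionSpaces.TorusDerivBounds
import Literature.Analysis.FunctionSpaces.TorusSobolevSup
import Literature.Analysis.FunctionSpaces.TorusInverseLaplacianCalculus
import HarnessLib

/-!
# Word derivatives on the flat torus: the dictionary with the lifted coordinate word
# derivatives, the Leibniz expansion, word energies and the Sobolev sup bound in word form
# (topic `Analysis/PDE`)

Analysis/PDE support file (everything proved; one definition with a body, no named facts) of
the energy method for quasilinear symmetric hyperbolic systems on `𝕋³` (Dafermos 2005,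
Thm 5.1.1; Majda 1984, Ch. 2, Thm 2.1), towards the named fact
`Literature.MathematicalPhysics.KineticTheory.hsEuler_localExistence`. The `H^m` energy
estimates of that method are organised along the iterated COORDINATE derivatives
`∂^w f = ∂_{w₀} ∂_{w₁} ⋯ f` of torus fields along words `w` in the index type
(`Torus.iterPartialDeriv`, `TorusDerivBounds`). The whole-space calculus of such word
derivatives — Leibniz expansion over `splittings`, Schwarz symmetry, Moser-type tame bounds on
compact sets (`CoordWordDeriv`, `CoordWordTame`) — is already in the tree for the LIFTED
derivatives `cwd w g` of functions `g` on `ℝⁿ`; this file is the dictionary that transports it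
to the torus, plus the torus-side bookkeeping:

* `lift_iterPartialDeriv_eq_cwd` — `lift (∂^w f) = cwd w (lift f)` for smooth `f`; hence
  Schwarz (`iterPartialDeriv_perm`) and the **Leibniz expansion**
  `∂^w (C g) = Σ_{(a,c) ∈ splittings w} (∂^a C)(∂^c g)` for an operator field `C` applied to a
  field `g` (`iterPartialDeriv_clm_apply`, commutator form `iterPartialDeriv_clm_apply_eq`);
* the closed unit cube `closedCube ι = [0,1]ⁿ` (compact, a fundamental domain up to a null
  set): `∫_𝕋 f = ∫_{[0,1]ⁿ} lift f`, `‖𝟙_{[0,1]ⁿ} lift f‖_{L²}² = ∫_𝕋 ‖f‖²`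
  (`l2On_closedCube_lift_sq`), and sup bounds transfer (`norm_le_of_forall_mem_closedCube`);
* `twordEnergy m f = Σ_{|w| ≤ m} ∫_𝕋 ‖∂^w f‖²` — the sum-form `H^m` energy, monotone in `m`,
  absorbing inner derivatives (`twordEnergy_iterPartialDeriv_le`), and controlling the lifted
  `L²([0,1]ⁿ)` sizes `‖𝟙 cwd w (lift f)‖_{L²} ≤ √(twordEnergy m f)`;
* **`H² ⊂ L^∞` in word form on `𝕋³`** (`exists_norm_sq_le_twordEnergy_two`, from the tree's
  `Torus.norm_sq_le_sobolev_two_of_isSmooth`): `‖∂^c f (x)‖² ≤ C_s · twordEnergy m f` whenever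
  `|c| + 2 ≤ m`, also for the lifted derivatives;
* time-dependent fields: word derivatives of jointly smooth fields are jointly smooth and
  `∂ₜ ∂^w = ∂^w ∂ₜ` for fields smooth on `ℝ × 𝕋ⁿ` (`timeDeriv_iterPartialDeriv_comm`).

## Mathlib / tree search

Tree: `Torus.iterPartialDeriv` and its algebra (`TorusDerivBounds`), `Torus.lift_lineDeriv`,
`Torus.fderiv_lift`, `Torus.integral_eq_integral_lift_holds`, `Torus.repr_mem_unitCube`
(`FlatTorus(Proofs)`, `TorusCalculus`), `cwd`, `splittings`, `cwd_bilinear`, `cwd_perm`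
(`CoordWordDeriv`), `l2On`, `wordsLE` (`CoordWordTame`, `SymmetricHyperbolicEnergy`),
`Torus.norm_sq_le_sobolev_two_of_isSmooth` (`TorusSobolevSup`),
`Torus.timeDerivWithin_partialDeriv_comm` (`TorusInverseLaplacianCalculus`). Nothing relating
`iterPartialDeriv` to `cwd` (`lean search 'iterPartialDeriv.*cwd|cwd.*lift'`). Mathlib:
`Measure.pi_hyperplane`, `EuclideanSpace.volume_preserving_measurableEquiv`,
`MemLp.eLpNorm_eq_integral_rpow_norm`.

## References

* A. Majda, *Compressible Fluid Flow and Systems of Conservation Laws in Several Space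
  Variables*, Springer 1984, Ch. 2 §2.1 (the `H^s` energy method; notation `D^α`).
  [`Majda1984`]
* C. M. Dafermos, *Hyperbolic Conservation Laws in Continuum Physics*, 2nd ed., Springer 2005,
  §5.1, proof of Thm 5.1.1 ((5.1.13): the differentiated equations). [`Dafermos2005`]
* R. A. Adams, *Sobolev Spaces*, Academic Press 1975, Thm. 5.4 Part I Case C. [`Adams1975`]
-/

noncomputable section

open MeasureTheory Set Filter Function
open scoped ContDiff InnerProductSpace Topology ENNReal

namespace Literature.Analysis.PDE

open Literature.Analysis.FunctionSpaces Literature.Analysis.FunctionSpaces.Torus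

variable {ι : Type*} [Fintype ι] [DecidableEq ι]
variable {F : Type*} [NormedAddCommGroup F] [NormedSpace ℝ F]

/-! ## Torus word derivatives and lifted coordinate word derivatives -/

section Dictionary

/-- `lift (∂ᵢ f) = ∂_[i] (lift f)` for `C¹` torus functions. [folklore] -/
theorem lift_partialDeriv_eq_cwd {f : UnitAddTorus ι → F} (hf : IsContDiff 1 f) (i : ι) :
    lift (partialDeriv i f) = cwd [i] (lift f) := by
  rw [cwd_singleton, bv_eq_single]
  exact lift_lineDeriv hf (EuclideanSpace.single i 1)

/-- **The dictionary**: `lift (∂^w f) = cwd w (lift f)` for smooth torus functions. [folklore] -/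
theorem lift_iterPartialDeriv_eq_cwd {f : UnitAddTorus ι → F} (hf : IsSmooth f) :
    ∀ w : List ι, lift (iterPartialDeriv w f) = cwd w (lift f)
  | [] => rfl
  | i :: w => by
    rw [iterPartialDeriv_cons,
      lift_partialDeriv_eq_cwd ((hf.iterPartialDeriv w).isContDiff (by simp)) i,
      lift_iterPartialDeriv_eq_cwd hf w, ← cwd_append]
    rfl

/-- Pointwise form of the dictionary: `∂^w f (proj y) = cwd w (lift f) y`. [folklore] -/
theorem iterPartialDeriv_apply_proj {f : UnitAddTorus ι → F} (hf : IsSmooth f) (w : List ι)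
    (y : EuclideanSpace ℝ ι) : iterPartialDeriv w f (proj y) = cwd w (lift f) y := by
  rw [← lift_iterPartialDeriv_eq_cwd hf w, lift_apply]

/-- **Schwarz on the torus**: word derivatives of smooth functions are invariant under
permutations of the word. [folklore] -/
theorem iterPartialDeriv_perm {f : UnitAddTorus ι → F} (hf : IsSmooth f) {w w' : List ι}
    (h : w.Perm w') : iterPartialDeriv w f = iterPartialDeriv w' f :=
  lift_injective (by rw [lift_iterPartialDeriv_eq_cwd hf, lift_iterPartialDeriv_eq_cwd hf, cwd_perm hf h])

/-- Outermost and innermost derivatives commute: `∂ᵢ ∂^w f = ∂^w ∂ᵢ f`. [folklore] -/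
theorem iterPartialDeriv_cons_eq {f : UnitAddTorus ι → F} (hf : IsSmooth f) (i : ι) (w : List ι) :
    iterPartialDeriv (i :: w) f = iterPartialDeriv w (partialDeriv i f) := by
  rw [← iterPartialDeriv_concat]
  exact iterPartialDeriv_perm hf (List.perm_append_singleton i w).symm

omit [DecidableEq ι] in
/-- Composition with a smooth map is smooth: `x ↦ G (V x)`. [folklore] -/
theorem isSmooth_comp {X : Type*} [NormedAddCommGroup X] [NormedSpace ℝ X] {G : F → X}
    (hG : ContDiff ℝ ∞ G) {V : UnitAddTorus ι → F} (hV : IsSmooth V) :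
    IsSmooth fun x => G (V x) :=
  hG.comp hV

omit [DecidableEq ι] in
/-- Composition of a jointly smooth field with a smooth map is jointly smooth. [folklore] -/
theorem isSmoothSpaceTimeOn_comp {X : Type*} [NormedAddCommGroup X] [NormedSpace ℝ X]
    {G : F → X} (hG : ContDiff ℝ ∞ G) {S : Set ℝ} {V : ℝ → UnitAddTorus ι → F}
    (hV : IsSmoothSpaceTimeOn S V) : IsSmoothSpaceTimeOn S fun t x => G (V t x) :=
  hG.comp_contDiffOn hV

variable {F' G' : Type*} [NormedAddCommGroup F'] [NormedSpace ℝ F'] [NormedAddCommGroup G']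
  [NormedSpace ℝ G']

/-- **Leibniz expansion on the torus**: for a smooth operator field `C` and a smooth field `g`,
`∂^w (C g) = Σ_{(a, c) ∈ splittings w} (∂^a C) (∂^c g)`. [cite: Evans2010, App. C.2] -/
theorem iterPartialDeriv_clm_apply {C : UnitAddTorus ι → (F' →L[ℝ] G')} {g : UnitAddTorus ι → F'}
    (hC : IsSmooth C) (hg : IsSmooth g) (w : List ι) :
    iterPartialDeriv w (fun x => C x (g x)) = fun x =>
      ((splittings w).map fun p => iterPartialDeriv p.1 C x (iterPartialDeriv p.2 g x)).sum := by
  apply lift_injective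
  rw [lift_iterPartialDeriv_eq_cwd (isSmooth_clm_apply hC hg) w]
  have h := cwd_bilinear (ContinuousLinearMap.id ℝ (F' →L[ℝ] G')) hC hg w
  simp only [ContinuousLinearMap.id_apply] at h
  have e1 : lift (fun x => C x (g x)) = fun y => (lift C y) (lift g y) := rfl
  rw [e1, h]
  funext y
  rw [lift_apply]
  congr 1
  refine List.map_congr_left fun p _ => ?_
  rw [iterPartialDeriv_apply_proj hC, iterPartialDeriv_apply_proj hg]

/-- **Commutator form of the Leibniz expansion on the torus**: `∂^w (C g) = C ∂^w g + Σ'` where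
`Σ'` runs over the splittings `(a, c)` with `a ≠ []` (`splittings w = ([], w) :: r`).
[cite: Evans2010, App. C.2] -/
theorem iterPartialDeriv_clm_apply_eq {C : UnitAddTorus ι → (F' →L[ℝ] G')} {g : UnitAddTorus ι → F'}
    (hC : IsSmooth C) (hg : IsSmooth g) {w : List ι} {r : List (List ι × List ι)}
    (hr : splittings w = ([], w) :: r) :
    iterPartialDeriv w (fun x => C x (g x)) = fun x =>
      C x (iterPartialDeriv w g x) +
        (r.map fun p => iterPartialDeriv p.1 C x (iterPartialDeriv p.2 g x)).sum := by
  rw [iterPartialDeriv_clm_apply hC hg w, hr]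
  funext x
  simp

end Dictionary

/-! ## The closed unit cube: integrals and sup norms of lifts -/

section Cube

variable (ι) in
/-- The closed unit cube `[0,1]ⁿ ⊂ ℝⁿ` (compact; the fundamental domain `unitCube` up to the null
set of its upper faces). [folklore] -/
def closedCube : Set (EuclideanSpace ℝ ι) := {y | ∀ i, y i ∈ Icc (0 : ℝ) 1}

omit [Fintype ι] [DecidableEq ι] in
/-- `[0,1)ⁿ ⊆ [0,1]ⁿ`. [folklore] -/
theorem unitCube_subset_closedCube : unitCube ι ⊆ closedCube ι :=
  fun _ hy i => Ico_subset_Icc_self (hy i)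

omit [Fintype ι] [DecidableEq ι] in
/-- The closed cube as the preimage of `Π [0,1]` under the coordinate isomorphism. [folklore] -/
theorem closedCube_eq_preimage :
    closedCube ι = (EuclideanSpace.equiv ι ℝ) ⁻¹' (univ.pi fun _ => Icc (0 : ℝ) 1) := by
  ext y
  simp only [closedCube, mem_setOf_eq, mem_preimage, mem_univ_pi]
  exact Iff.rfl

omit [Fintype ι] [DecidableEq ι] in
/-- The closed cube is compact. [folklore] -/
theorem isCompact_closedCube : IsCompact (closedCube ι) := by
  rw [closedCube_eq_preimage, ← ContinuousLinearEquiv.image_symm_eq_preimage]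
  exact (isCompact_univ_pi fun _ => isCompact_Icc).image
    (EuclideanSpace.equiv ι ℝ).symm.continuous

omit [DecidableEq ι] in
/-- A coordinate hyperplane is a null set. [folklore] -/
theorem volume_setOf_apply_eq (i : ι) (c : ℝ) :
    volume {y : EuclideanSpace ℝ ι | y i = c} = 0 := by
  have hset : {y : EuclideanSpace ℝ ι | y i = c} =
      (WithLp.ofLp : EuclideanSpace ℝ ι → (ι → ℝ)) ⁻¹' {f : ι → ℝ | f i = c} := rfl
  have hmeas : MeasurableSet {f : ι → ℝ | f i = c} :=
    measurableSet_eq_fun (measurable_pi_apply i) measurable_const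
  rw [hset, (PiLp.volume_preserving_ofLp ι).measure_preimage hmeas.nullMeasurableSet]
  exact Measure.pi_hyperplane (μ := fun _ : ι => (volume : Measure ℝ)) i c

omit [DecidableEq ι] in
/-- The closed cube exceeds the half-open one by a null set. [folklore] -/
theorem volume_closedCube_diff_unitCube : volume (closedCube ι \ unitCube ι) = 0 := by
  have hsub : closedCube ι \ unitCube ι ⊆ ⋃ i, {y : EuclideanSpace ℝ ι | y i = 1} := by
    rintro y ⟨hy, hy'⟩
    simp only [mem_unitCube, not_forall] at hy'
    obtain ⟨i, hi⟩ := hy'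
    refine mem_iUnion.2 ⟨i, ?_⟩
    have h1 := hy i
    simp only [mem_Ico, not_and, not_lt] at hi
    exact le_antisymm h1.2 (hi h1.1)
  exact measure_mono_null hsub ((measure_iUnion_null_iff).2 fun i => volume_setOf_apply_eq i 1)

omit [DecidableEq ι] in
/-- The two cubes agree almost everywhere. [folklore] -/
theorem unitCube_ae_eq_closedCube :
    (unitCube ι : Set (EuclideanSpace ℝ ι)) =ᵐ[volume] closedCube ι := by
  refine ae_eq_set.2 ⟨?_, volume_closedCube_diff_unitCube⟩
  rw [sdiff_eq_empty.2 unitCube_subset_closedCube, measure_empty]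

omit [DecidableEq ι] in
/-- **`∫_𝕋 f = ∫_{[0,1]ⁿ} lift f`**. [cite: Grafakos2014, §3.1.1] -/
theorem integral_eq_integral_closedCube_lift (f : UnitAddTorus ι → F) :
    ∫ x, f x = ∫ y in closedCube ι, lift f y := by
  rw [integral_eq_integral_lift_holds f]
  exact setIntegral_congr_set unitCube_ae_eq_closedCube

omit [DecidableEq ι] [NormedSpace ℝ F] in
/-- **`‖𝟙_{[0,1]ⁿ} lift f‖²_{L²(ℝⁿ)} = ∫_𝕋 ‖f‖²`** for continuous `f`. [folklore] -/
theorem l2On_closedCube_lift_sq {f : UnitAddTorus ι → F} (hf : Continuous f) :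
    l2On (closedCube ι) (lift f) ^ 2 = ∫ x, ‖f x‖ ^ 2 := by
  have hK := isCompact_closedCube (ι := ι)
  have hlc : Continuous (lift f) := hf.comp continuous_proj
  have hmem : MemLp (lift f) 2 ((volume : Measure (EuclideanSpace ℝ ι)).restrict (closedCube ι)) :=
    (memLp_indicator_iff_restrict hK.measurableSet).1 (memLp_indicator hK hlc)
  have hI : 0 ≤ ∫ y in closedCube ι, ‖lift f y‖ ^ 2 := integral_nonneg fun _ => sq_nonneg _
  rw [l2On_def, eLpNorm_indicator_eq_restrict hK.measurableSet,
    hmem.eLpNorm_eq_integral_rpow_norm two_ne_zero ENNReal.ofNat_ne_top]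
  simp only [ENNReal.toReal_ofNat, Real.rpow_two]
  rw [ENNReal.toReal_ofReal (Real.rpow_nonneg hI _), show (2 : ℝ)⁻¹ = 1 / 2 by norm_num,
    ← Real.sqrt_eq_rpow, Real.sq_sqrt hI,
    integral_eq_integral_closedCube_lift (fun x => ‖f x‖ ^ 2)]
  rfl

omit [Fintype ι] [DecidableEq ι] [NormedSpace ℝ F] in
/-- Sup bounds on the closed cube are sup bounds on the torus. [folklore] -/
theorem norm_le_of_forall_mem_closedCube {f : UnitAddTorus ι → F} {C : ℝ}
    (h : ∀ y ∈ closedCube ι, ‖lift f y‖ ≤ C) (x : UnitAddTorus ι) : ‖f x‖ ≤ C := by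
  have := h (repr x) (unitCube_subset_closedCube (repr_mem_unitCube x))
  rwa [lift_apply, proj_repr] at this

end Cube

/-! ## Word energies -/

section Energy

/-- **The sum-form `H^m` energy of a torus field**: `Σ_{|w| ≤ m} ∫_𝕋 ‖∂^w f‖²` (Majda's
`‖u‖²_m` with ordered multi-indices counted with multiplicity). [cite: Majda1984, Ch. 2 §2.1] -/
def twordEnergy (m : ℕ) (f : UnitAddTorus ι → F) : ℝ :=
  ∑ w ∈ wordsLE ι m, ∫ x, ‖iterPartialDeriv w f x‖ ^ 2

/-- Unfolding. [folklore] -/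
theorem twordEnergy_def (m : ℕ) (f : UnitAddTorus ι → F) :
    twordEnergy m f = ∑ w ∈ wordsLE ι m, ∫ x, ‖iterPartialDeriv w f x‖ ^ 2 := rfl

/-- `0 ≤ twordEnergy m f`. [folklore] -/
theorem twordEnergy_nonneg (m : ℕ) (f : UnitAddTorus ι → F) : 0 ≤ twordEnergy m f :=
  Finset.sum_nonneg fun _ _ => integral_nonneg fun _ => sq_nonneg _

/-- A single word is dominated by the energy. [folklore] -/
theorem integral_norm_sq_iterPartialDeriv_le_twordEnergy {m : ℕ} {w : List ι} (hw : w.length ≤ m)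
    (f : UnitAddTorus ι → F) : ∫ x, ‖iterPartialDeriv w f x‖ ^ 2 ≤ twordEnergy m f :=
  Finset.single_le_sum (f := fun w => ∫ x, ‖iterPartialDeriv w f x‖ ^ 2)
    (fun _ _ => integral_nonneg fun _ => sq_nonneg _) (mem_wordsLE.2 hw)

/-- In particular `∫ ‖f‖² ≤ twordEnergy m f`. [folklore] -/
theorem integral_norm_sq_le_twordEnergy (m : ℕ) (f : UnitAddTorus ι → F) :
    ∫ x, ‖f x‖ ^ 2 ≤ twordEnergy m f :=
  integral_norm_sq_iterPartialDeriv_le_twordEnergy (w := []) (Nat.zero_le m) f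

/-- Monotonicity in the order. [folklore] -/
theorem twordEnergy_mono {k m : ℕ} (h : k ≤ m) (f : UnitAddTorus ι → F) :
    twordEnergy k f ≤ twordEnergy m f :=
  Finset.sum_le_sum_of_subset_of_nonneg (wordsLE_mono h)
    fun _ _ _ => integral_nonneg fun _ => sq_nonneg _

/-- **Inner derivatives are absorbed**: `twordEnergy k (∂^c f) ≤ twordEnergy m f` when
`k + |c| ≤ m`. [folklore] -/
theorem twordEnergy_iterPartialDeriv_le {k m : ℕ} {c : List ι} (h : k + c.length ≤ m)
    (f : UnitAddTorus ι → F) : twordEnergy k (iterPartialDeriv c f) ≤ twordEnergy m f := by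
  rw [twordEnergy_def, twordEnergy_def]
  simp_rw [← iterPartialDeriv_append]
  have hinj : ∀ a ∈ wordsLE ι k, ∀ b ∈ wordsLE ι k, a ++ c = b ++ c → a = b :=
    fun a _ b _ hab => List.append_cancel_right hab
  rw [← Finset.sum_image (f := fun w => ∫ x, ‖iterPartialDeriv w f x‖ ^ 2) hinj]
  refine Finset.sum_le_sum_of_subset_of_nonneg (fun w hw => ?_)
    fun _ _ _ => integral_nonneg fun _ => sq_nonneg _
  obtain ⟨a, ha, rfl⟩ := Finset.mem_image.1 hw
  rw [mem_wordsLE] at ha ⊢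
  rw [List.length_append]
  omega

/-- The lifted `L²([0,1]ⁿ)` size of a word derivative is its torus `L²` norm. [folklore] -/
theorem l2On_cwd_lift_sq {f : UnitAddTorus ι → F} (hf : IsSmooth f) (w : List ι) :
    l2On (closedCube ι) (cwd w (lift f)) ^ 2 = ∫ x, ‖iterPartialDeriv w f x‖ ^ 2 := by
  rw [← lift_iterPartialDeriv_eq_cwd hf w, l2On_closedCube_lift_sq (hf.iterPartialDeriv w).continuous]

/-- **`L²` control of the lifted word derivatives by the energy**:
`‖𝟙_{[0,1]ⁿ} cwd w (lift f)‖_{L²} ≤ √(twordEnergy m f)` for `|w| ≤ m`. [folklore] -/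
theorem l2On_cwd_lift_le_sqrt_twordEnergy {f : UnitAddTorus ι → F} (hf : IsSmooth f) {m : ℕ}
    {w : List ι} (hw : w.length ≤ m) : l2On (closedCube ι) (cwd w (lift f)) ≤ √(twordEnergy m f) := by
  rw [← Real.sqrt_sq (l2On_nonneg _ _), l2On_cwd_lift_sq hf w]
  exact Real.sqrt_le_sqrt (integral_norm_sq_iterPartialDeriv_le_twordEnergy hw f)

end Energy

/-! ## The Sobolev sup bound in word form on `𝕋³` -/

section Sobolev

variable {F' : Type*} [NormedAddCommGroup F'] [NormedSpace ℝ F'] [FiniteDimensional ℝ F']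

/-- **`H²(𝕋³) ⊂ L^∞(𝕋³)` in word form**: on `𝕋^ι` with `card ι = 3` there is `C_s > 0` with
`‖f x‖² ≤ C_s · twordEnergy 2 f` for every smooth `f` and every `x`.
[cite: Adams1975, Thm. 5.4 Part I Case C (mp > n)] -/
theorem exists_norm_sq_le_twordEnergy_two (hd : Fintype.card ι = 3) :
    ∃ Cs : ℝ, 0 < Cs ∧ ∀ f : UnitAddTorus ι → F', IsSmooth f → ∀ x,
      ‖f x‖ ^ 2 ≤ Cs * twordEnergy 2 f := by
  obtain ⟨K, hK, h⟩ := norm_sq_le_sobolev_two_of_isSmooth (F' := F') hd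
  refine ⟨3 * K, by positivity, fun f hf x => (h f hf x).trans ?_⟩
  have hnn : ∀ w : List ι, 0 ≤ ∫ y, ‖iterPartialDeriv w f y‖ ^ 2 :=
    fun w => integral_nonneg fun _ => sq_nonneg _
  have e0 : ∫ y, ‖f y‖ ^ 2 ≤ twordEnergy 2 f := integral_norm_sq_le_twordEnergy 2 f
  have e1 : ∑ i, ∫ y, ‖partialDeriv i f y‖ ^ 2 ≤ twordEnergy 2 f := by
    have hinj : ∀ a ∈ (Finset.univ : Finset ι), ∀ b ∈ (Finset.univ : Finset ι),
        [a] = [b] → a = b := fun a _ b _ hab => List.singleton_injective hab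
    have : ∑ i, ∫ y, ‖partialDeriv i f y‖ ^ 2 =
        ∑ w ∈ (Finset.univ : Finset ι).image fun i => [i], ∫ y, ‖iterPartialDeriv w f y‖ ^ 2 := by
      rw [Finset.sum_image hinj]
      rfl
    rw [this]
    refine Finset.sum_le_sum_of_subset_of_nonneg (fun w hw => ?_) fun w _ _ => hnn w
    obtain ⟨i, -, rfl⟩ := Finset.mem_image.1 hw
    exact mem_wordsLE.2 (by simp)
  have e2 : ∑ i, ∑ j, ∫ y, ‖partialDeriv i (partialDeriv j f) y‖ ^ 2 ≤ twordEnergy 2 f := by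
    have hinj : ∀ a ∈ (Finset.univ : Finset (ι × ι)), ∀ b ∈ (Finset.univ : Finset (ι × ι)),
        [a.1, a.2] = [b.1, b.2] → a = b := by
      intro a _ b _ hab
      simp only [List.cons.injEq, and_true] at hab
      exact Prod.ext hab.1 hab.2
    have : ∑ i, ∑ j, ∫ y, ‖partialDeriv i (partialDeriv j f) y‖ ^ 2 =
        ∑ w ∈ (Finset.univ : Finset (ι × ι)).image fun p => [p.1, p.2],
          ∫ y, ‖iterPartialDeriv w f y‖ ^ 2 := by
      rw [Finset.sum_image hinj, ← Finset.univ_product_univ, Finset.sum_product]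
      rfl
    rw [this]
    refine Finset.sum_le_sum_of_subset_of_nonneg (fun w hw => ?_) fun w _ _ => hnn w
    obtain ⟨p, -, rfl⟩ := Finset.mem_image.1 hw
    exact mem_wordsLE.2 (by simp)
  have hE := twordEnergy_nonneg 2 f
  nlinarith

omit [FiniteDimensional ℝ F'] in
/-- **Sup bound for word derivatives**: with the constant of `exists_norm_sq_le_twordEnergy_two`,
`‖∂^c f (x)‖² ≤ C_s · twordEnergy m f` whenever `|c| + 2 ≤ m`.
[cite: Adams1975, Thm. 5.4 Part I Case C (mp > n)] -/
theorem norm_sq_iterPartialDeriv_le_twordEnergy {Cs : ℝ}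
    (hCs : ∀ f : UnitAddTorus ι → F', IsSmooth f → ∀ x, ‖f x‖ ^ 2 ≤ Cs * twordEnergy 2 f)
    (hCs0 : 0 ≤ Cs) {f : UnitAddTorus ι → F'} (hf : IsSmooth f) {c : List ι} {m : ℕ}
    (hc : c.length + 2 ≤ m) (x : UnitAddTorus ι) :
    ‖iterPartialDeriv c f x‖ ^ 2 ≤ Cs * twordEnergy m f :=
  (hCs _ (hf.iterPartialDeriv c) x).trans (mul_le_mul_of_nonneg_left
    (twordEnergy_iterPartialDeriv_le (by omega) f) hCs0)

omit [FiniteDimensional ℝ F'] in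
/-- The same for the lifted derivatives, at every point of `ℝⁿ`. [folklore] -/
theorem norm_sq_cwd_lift_le_twordEnergy {Cs : ℝ}
    (hCs : ∀ f : UnitAddTorus ι → F', IsSmooth f → ∀ x, ‖f x‖ ^ 2 ≤ Cs * twordEnergy 2 f)
    (hCs0 : 0 ≤ Cs) {f : UnitAddTorus ι → F'} (hf : IsSmooth f) {c : List ι} {m : ℕ}
    (hc : c.length + 2 ≤ m) (y : EuclideanSpace ℝ ι) :
    ‖cwd c (lift f) y‖ ^ 2 ≤ Cs * twordEnergy m f := by
  rw [← iterPartialDeriv_apply_proj hf]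
  exact norm_sq_iterPartialDeriv_le_twordEnergy hCs hCs0 hf hc _

omit [FiniteDimensional ℝ F'] in
/-- Norm form: `‖cwd c (lift f) y‖ ≤ √(C_s · twordEnergy m f)`. [folklore] -/
theorem norm_cwd_lift_le_sqrt {Cs : ℝ}
    (hCs : ∀ f : UnitAddTorus ι → F', IsSmooth f → ∀ x, ‖f x‖ ^ 2 ≤ Cs * twordEnergy 2 f)
    (hCs0 : 0 ≤ Cs) {f : UnitAddTorus ι → F'} (hf : IsSmooth f) {c : List ι} {m : ℕ}
    (hc : c.length + 2 ≤ m) (y : EuclideanSpace ℝ ι) :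
    ‖cwd c (lift f) y‖ ≤ √(Cs * twordEnergy m f) := by
  rw [← Real.sqrt_sq (norm_nonneg _)]
  exact Real.sqrt_le_sqrt (norm_sq_cwd_lift_le_twordEnergy hCs hCs0 hf hc y)

end Sobolev

/-! ## Time-dependent fields -/

section Time

variable {S : Set ℝ} {u : ℝ → UnitAddTorus ι → F}

/-- Word derivatives of jointly smooth fields are jointly smooth (on time sets of unique
differentiability). [folklore] -/
theorem isSmoothSpaceTimeOn_iterPartialDeriv (hu : IsSmoothSpaceTimeOn S u) (hS : UniqueDiffOn ℝ S) :
    ∀ w : List ι, IsSmoothSpaceTimeOn S fun t => iterPartialDeriv w (u t)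
  | [] => hu
  | i :: w => (isSmoothSpaceTimeOn_iterPartialDeriv hu hS w).partialDeriv hS i

omit [DecidableEq ι] in
/-- A field jointly smooth on `ℝ × 𝕋ⁿ` has a smooth space–time lift. [folklore] -/
theorem contDiff_stLift_of_isSmoothSpaceTimeOn_univ (hu : IsSmoothSpaceTimeOn univ u) :
    ContDiff ℝ ∞ (stLift u) := by
  rwa [IsSmoothSpaceTimeOn, univ_prod_univ, contDiffOn_univ] at hu

/-- **`∂ₜ ∂ⱼ = ∂ⱼ ∂ₜ`** for fields jointly smooth on `ℝ × 𝕋ⁿ`. [folklore] -/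
theorem timeDeriv_partialDeriv_comm (hu : IsSmoothSpaceTimeOn univ u) (j : ι) (t : ℝ)
    (x : UnitAddTorus ι) :
    timeDeriv (fun s => partialDeriv j (u s)) t x = partialDeriv j (timeDeriv u t) x := by
  have hab : t - 1 < t + 1 := by linarith
  have ht : t ∈ Icc (t - 1) (t + 1) := ⟨by linarith, by linarith⟩
  have h := timeDerivWithin_partialDeriv_comm hab (hu.mono (subset_univ _)) ht j x
  have hψ : ContDiff ℝ ∞ (stLift u) := contDiff_stLift_of_isSmoothSpaceTimeOn_univ hu
  have hψj : ContDiff ℝ ∞ (stLift fun s => partialDeriv j (u s)) :=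
    contDiff_stLift_of_isSmoothSpaceTimeOn_univ (hu.partialDeriv uniqueDiffOn_univ j)
  rw [timeDerivWithin_eq_timeDeriv_of_contDiff hψj (uniqueDiffOn_Icc hab) ht] at h
  rw [h]
  have hslice : timeDerivWithin (Icc (t - 1) (t + 1)) u t = timeDeriv u t :=
    funext fun z => timeDerivWithin_eq_timeDeriv_of_contDiff hψ (uniqueDiffOn_Icc hab) ht z
  rw [hslice]

/-- **`∂ₜ ∂^w = ∂^w ∂ₜ`** for fields jointly smooth on `ℝ × 𝕋ⁿ`. [folklore] -/
theorem timeDeriv_iterPartialDeriv_comm (hu : IsSmoothSpaceTimeOn univ u) :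
    ∀ (w : List ι) (t : ℝ) (x : UnitAddTorus ι),
      timeDeriv (fun s => iterPartialDeriv w (u s)) t x = iterPartialDeriv w (timeDeriv u t) x
  | [], _, _ => rfl
  | i :: w, t, x => by
    have h1 := isSmoothSpaceTimeOn_iterPartialDeriv hu uniqueDiffOn_univ w
    rw [iterPartialDeriv_cons]
    change timeDeriv (fun s => partialDeriv i (iterPartialDeriv w (u s))) t x = _
    rw [timeDeriv_partialDeriv_comm h1 i t x]
    have hslice : timeDeriv (fun s => iterPartialDeriv w (u s)) t = iterPartialDeriv w (timeDeriv u t) :=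
      funext fun z => timeDeriv_iterPartialDeriv_comm hu w t z
    rw [hslice]

omit [DecidableEq ι] in
/-- The time derivative of a field jointly smooth on `ℝ × 𝕋ⁿ` is jointly smooth. [folklore] -/
theorem isSmoothSpaceTimeOn_timeDeriv (hu : IsSmoothSpaceTimeOn univ u) :
    IsSmoothSpaceTimeOn univ (timeDeriv u) := by
  have h := hu.timeDerivWithin uniqueDiffOn_univ
  have hψ : ContDiff ℝ ∞ (stLift u) := contDiff_stLift_of_isSmoothSpaceTimeOn_univ hu
  have heq : timeDerivWithin univ u = timeDeriv u :=
    funext fun t => funext fun x =>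
      timeDerivWithin_eq_timeDeriv_of_contDiff hψ uniqueDiffOn_univ (mem_univ t) x
  rwa [heq] at h

end Time

end Literature.Analysis.PDE

end
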